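import Literature.MathematicalPhysics.StatisticalMechanics.BarlowCoordination
import HarnessLib

/-!
# Contact tetrahedra of a Barlow stacking are `3 + 1` on adjacent layers

HONEST FRAMING. Part of the venture `Summits/Ventures/Crystal3D` (cells `pub-crystal3d`,
`crystal3d-full`). Elementary lattice combinatorics of the touching Barlow stackings
`barlowStacking 1 √(2/3) σ` (any Hägg sequence `σ`); nothing here is a claim about ground states
or three-dimensional crystallization.

**Theorem** (`barlow_tetrahedron_layers`; **eng LEMMA 0** of the cell `crystal3d-full`,
HOME/eng/LEMMAS-b-bracket.md, typed as `BarlowTetrahedronLayers` in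
HOME/cf-p1/lean/WulffSelection.lean, ROUTE.md §11.4/§16). Four mutually touching balls of a
Barlow packing consist of an in-layer unit triangle and an apex in the layer directly above or
below it: for sites `(k m, i m, j m)`, `m : Fin 4`, pairwise at distance `1`, there are `m₀` and a
layer `l` with `k m = l` for `m ≠ m₀` and `k m₀ = l ± 1`.

Proof. By the shell description of `BarlowCoordination.dist_barlowPos_eq_iff`, touching sites lie
in the same layer (offset in `sixOffsets`) or in adjacent layers (offset in `threeOffsets (±1)`).
So the four layers lie in a window `{l, l+1}`; four sites in ONE layer cannot touch pairwise (the
triangular lattice has no `K₄`, `no_inLayer_K4`), and a `2 + 2` split is impossible (two touching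
sites of the upper layer cannot both touch the same two touching sites of the lower layer,
`no_twoTwo_split`) — both by `decide` over the finite offset tables; the remaining splits are
`3 + 1`.

WHAT THIS IS NOT: not a statement about off-lattice packings; the bipyramid-axis lemma (eng LEMMA 1)
and the registration lemma (LEMMA 2) are not proved here.
-/

noncomputable section

namespace Summit.Ventures.Crystal3D

open Literature.MathematicalPhysics.StatisticalMechanics (barlowPos IsHaggSeq sixOffsets
  threeOffsets dist_barlowPos_eq_iff)

/-! ## Finite offset combinatorics (`decide`) -/

/-- The triangular lattice has no `K₄`: three in-layer neighbour offsets `u, v, w` of a site cannot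
be pairwise neighbours. -/
theorem sixOffsets_no_K4 :
    ∀ u ∈ sixOffsets, ∀ v ∈ sixOffsets, ∀ w ∈ sixOffsets,
      v - u ∈ sixOffsets → w - u ∈ sixOffsets → w - v ∈ sixOffsets → False := by
  decide

/-- No `2 + 2` split, letter shift `+1`: if `u` is an in-layer neighbour offset and `x, y` are
adjacent-layer offsets (`threeOffsets 1`) from the same site such that `x − u, y − u` are also
adjacent-layer offsets, then `y − x` is not an in-layer neighbour offset. -/
theorem no_twoTwo_offsets_pos :
    ∀ u ∈ sixOffsets, ∀ x ∈ threeOffsets 1, ∀ y ∈ threeOffsets 1,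
      x - u ∈ threeOffsets 1 → y - u ∈ threeOffsets 1 → y - x ∈ sixOffsets → False := by
  decide

/-- No `2 + 2` split, letter shift `−1`. -/
theorem no_twoTwo_offsets_neg :
    ∀ u ∈ sixOffsets, ∀ x ∈ threeOffsets (-1), ∀ y ∈ threeOffsets (-1),
      x - u ∈ threeOffsets (-1) → y - u ∈ threeOffsets (-1) → y - x ∈ sixOffsets → False := by
  decide

/-- **No in-layer `K₄`** in absolute in-layer coordinates: four sites of one layer are not
pairwise in-layer neighbours. -/
theorem no_inLayer_K4 (i₀ j₀ i₁ j₁ i₂ j₂ i₃ j₃ : ℤ)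
    (h01 : (i₀ - i₁, j₀ - j₁) ∈ sixOffsets) (h02 : (i₀ - i₂, j₀ - j₂) ∈ sixOffsets)
    (h03 : (i₀ - i₃, j₀ - j₃) ∈ sixOffsets) (h12 : (i₁ - i₂, j₁ - j₂) ∈ sixOffsets)
    (h13 : (i₁ - i₃, j₁ - j₃) ∈ sixOffsets) (h23 : (i₂ - i₃, j₂ - j₃) ∈ sixOffsets) : False := by
  have e12 : ((i₁ - i₂, j₁ - j₂) : ℤ × ℤ) = (i₀ - i₂, j₀ - j₂) - (i₀ - i₁, j₀ - j₁) := by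
    simp only [Prod.mk_sub_mk, sub_sub_sub_cancel_left]
  have e13 : ((i₁ - i₃, j₁ - j₃) : ℤ × ℤ) = (i₀ - i₃, j₀ - j₃) - (i₀ - i₁, j₀ - j₁) := by
    simp only [Prod.mk_sub_mk, sub_sub_sub_cancel_left]
  have e23 : ((i₂ - i₃, j₂ - j₃) : ℤ × ℤ) = (i₀ - i₃, j₀ - j₃) - (i₀ - i₂, j₀ - j₂) := by
    simp only [Prod.mk_sub_mk, sub_sub_sub_cancel_left]
  rw [e12] at h12; rw [e13] at h13; rw [e23] at h23
  exact sixOffsets_no_K4 _ h01 _ h02 _ h03 h12 h13 h23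

/-- **No `2 + 2` split** in absolute coordinates: two in-layer neighbours `(i₀,j₀), (i₁,j₁)` of
layer `l` and two in-layer neighbours `(i_c,j_c), (i_d,j_d)` of layer `l + 1` (letter shift `τ`)
cannot have all four cross pairs touching. -/
theorem no_twoTwo_split (τ : ℤ) (hτ : τ = 1 ∨ τ = -1) (i₀ j₀ i₁ j₁ ic jc id jd : ℤ)
    (h01 : (i₀ - i₁, j₀ - j₁) ∈ sixOffsets) (h0c : (i₀ - ic, j₀ - jc) ∈ threeOffsets τ)
    (h1c : (i₁ - ic, j₁ - jc) ∈ threeOffsets τ) (h0d : (i₀ - id, j₀ - jd) ∈ threeOffsets τ)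
    (h1d : (i₁ - id, j₁ - jd) ∈ threeOffsets τ) (hcd : (ic - id, jc - jd) ∈ sixOffsets) :
    False := by
  have e1c : ((i₁ - ic, j₁ - jc) : ℤ × ℤ) = (i₀ - ic, j₀ - jc) - (i₀ - i₁, j₀ - j₁) := by
    simp only [Prod.mk_sub_mk, sub_sub_sub_cancel_left]
  have e1d : ((i₁ - id, j₁ - jd) : ℤ × ℤ) = (i₀ - id, j₀ - jd) - (i₀ - i₁, j₀ - j₁) := by
    simp only [Prod.mk_sub_mk, sub_sub_sub_cancel_left]
  have ecd : ((ic - id, jc - jd) : ℤ × ℤ) = (i₀ - id, j₀ - jd) - (i₀ - ic, j₀ - jc) := by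
    simp only [Prod.mk_sub_mk, sub_sub_sub_cancel_left]
  rw [e1c] at h1c; rw [e1d] at h1d; rw [ecd] at hcd
  rcases hτ with rfl | rfl
  · exact no_twoTwo_offsets_pos _ h01 _ h0c _ h0d h1c h1d hcd
  · exact no_twoTwo_offsets_neg _ h01 _ h0c _ h0d h1c h1d hcd

/-! ## The `3 + 1` lemma -/

/-- **eng LEMMA 0 (`BarlowTetrahedronLayers`): contact tetrahedra are `3 + 1` on adjacent
layers.** For a Hägg sequence `σ` and four sites of `barlowStacking 1 √(2/3) σ` pairwise at
distance `1`, three of them lie in one layer `l` and the fourth in layer `l + 1` or `l − 1`. -/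
theorem barlow_tetrahedron_layers :
    ∀ σ : ℤ → ℤ, IsHaggSeq σ → ∀ k i j : Fin 4 → ℤ,
      (∀ m n : Fin 4, m ≠ n →
          dist (barlowPos 1 (Real.sqrt (2 / 3)) σ (k m) (i m) (j m))
               (barlowPos 1 (Real.sqrt (2 / 3)) σ (k n) (i n) (j n)) = 1) →
        ∃ m₀ : Fin 4, ∃ l : ℤ, (∀ m, m ≠ m₀ → k m = l) ∧ (k m₀ = l + 1 ∨ k m₀ = l - 1) := by
  intro σ hσ k i j hd
  have hh : (Real.sqrt (2 / 3)) ^ 2 = 2 / 3 * (1 : ℝ) ^ 2 := by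
    rw [Real.sq_sqrt (by norm_num)]; ring
  have hshell : ∀ m n : Fin 4, m ≠ n →
      (k n = k m ∧ (i m - i n, j m - j n) ∈ sixOffsets) ∨
      (k n = k m + 1 ∧ (i m - i n, j m - j n) ∈ threeOffsets (-σ (k m))) ∨
      (k n = k m - 1 ∧ (i m - i n, j m - j n) ∈ threeOffsets (σ (k m - 1))) := fun m n hmn =>
    (dist_barlowPos_eq_iff hσ one_pos hh _ _ _ _ _ _).1 (hd m n hmn)
  have hgap : ∀ m n : Fin 4, m ≠ n → k n = k m ∨ k n = k m + 1 ∨ k n = k m - 1 := by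
    intro m n hmn
    rcases hshell m n hmn with ⟨h, -⟩ | ⟨h, -⟩ | ⟨h, -⟩
    · exact Or.inl h
    · exact Or.inr (Or.inl h)
    · exact Or.inr (Or.inr h)
  have hin : ∀ m n : Fin 4, ∀ l : ℤ, m ≠ n → k m = l → k n = l →
      (i m - i n, j m - j n) ∈ sixOffsets := by
    intro m n l hmn hm hn
    rcases hshell m n hmn with ⟨-, h⟩ | ⟨h, -⟩ | ⟨h, -⟩
    · exact h
    · omega
    · omega
  have hup : ∀ m n : Fin 4, ∀ l : ℤ, k m = l → k n = l + 1 →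
      (i m - i n, j m - j n) ∈ threeOffsets (-σ l) := by
    intro m n l hm hn
    have hmn : m ≠ n := by rintro rfl; omega
    rcases hshell m n hmn with ⟨h, -⟩ | ⟨-, h⟩ | ⟨h, -⟩
    · omega
    · rw [hm] at h; exact h
    · omega
  have hτ : ∀ l : ℤ, -σ l = 1 ∨ -σ l = -1 := fun l => by
    rcases hσ l with h | h <;> omega
  have noK4 := no_inLayer_K4
  have no22 := no_twoTwo_split
  rcases hgap 0 1 (by decide) with h1 | h1 | h1 <;>
    rcases hgap 0 2 (by decide) with h2 | h2 | h2 <;>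
      rcases hgap 0 3 (by decide) with h3 | h3 | h3
  · -- layers: k1 = k0, k2 = k0, k3 = k0
    exact (noK4 _ _ _ _ _ _ _ _ (hin 0 1 (k 0) (by decide) rfl (by omega))
      (hin 0 2 (k 0) (by decide) rfl (by omega)) (hin 0 3 (k 0) (by decide) rfl (by omega))
      (hin 1 2 (k 0) (by decide) (by omega) (by omega))
      (hin 1 3 (k 0) (by decide) (by omega) (by omega))
      (hin 2 3 (k 0) (by decide) (by omega) (by omega))).elim
  · -- layers: k1 = k0, k2 = k0, k3 = k0+1
    exact ⟨3, k 0, fun m hm => by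
        have : m = 0 ∨ m = 1 ∨ m = 2 ∨ m = 3 := by omega
        rcases this with rfl | rfl | rfl | rfl <;> omega, Or.inl (by omega)⟩
  · -- layers: k1 = k0, k2 = k0, k3 = k0-1
    exact ⟨3, k 0, fun m hm => by
        have : m = 0 ∨ m = 1 ∨ m = 2 ∨ m = 3 := by omega
        rcases this with rfl | rfl | rfl | rfl <;> omega, Or.inr (by omega)⟩
  · -- layers: k1 = k0, k2 = k0+1, k3 = k0
    exact ⟨2, k 0, fun m hm => by
        have : m = 0 ∨ m = 1 ∨ m = 2 ∨ m = 3 := by omega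
        rcases this with rfl | rfl | rfl | rfl <;> omega, Or.inl (by omega)⟩
  · -- layers: k1 = k0, k2 = k0+1, k3 = k0+1
    exact (no22 _ (hτ (k 0)) _ _ _ _ _ _ _ _ (hin 0 1 (k 0) (by decide) (by omega) (by omega))
      (hup 0 2 (k 0) (by omega) (by omega)) (hup 1 2 (k 0) (by omega) (by omega))
      (hup 0 3 (k 0) (by omega) (by omega)) (hup 1 3 (k 0) (by omega) (by omega))
      (hin 2 3 (k 0 + 1) (by decide) (by omega) (by omega))).elim
  · -- layers: k1 = k0, k2 = k0+1, k3 = k0-1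
    exfalso; rcases hgap 2 3 (by decide) with h | h | h <;> omega
  · -- layers: k1 = k0, k2 = k0-1, k3 = k0
    exact ⟨2, k 0, fun m hm => by
        have : m = 0 ∨ m = 1 ∨ m = 2 ∨ m = 3 := by omega
        rcases this with rfl | rfl | rfl | rfl <;> omega, Or.inr (by omega)⟩
  · -- layers: k1 = k0, k2 = k0-1, k3 = k0+1
    exfalso; rcases hgap 3 2 (by decide) with h | h | h <;> omega
  · -- layers: k1 = k0, k2 = k0-1, k3 = k0-1
    exact (no22 _ (hτ (k 0 - 1)) _ _ _ _ _ _ _ _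
      (hin 2 3 (k 0 - 1) (by decide) (by omega) (by omega))
      (hup 2 0 (k 0 - 1) (by omega) (by omega)) (hup 3 0 (k 0 - 1) (by omega) (by omega))
      (hup 2 1 (k 0 - 1) (by omega) (by omega)) (hup 3 1 (k 0 - 1) (by omega) (by omega))
      (hin 0 1 (k 0) (by decide) (by omega) (by omega))).elim
  · -- layers: k1 = k0+1, k2 = k0, k3 = k0
    exact ⟨1, k 0, fun m hm => by
        have : m = 0 ∨ m = 1 ∨ m = 2 ∨ m = 3 := by omega
        rcases this with rfl | rfl | rfl | rfl <;> omega, Or.inl (by omega)⟩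
  · -- layers: k1 = k0+1, k2 = k0, k3 = k0+1
    exact (no22 _ (hτ (k 0)) _ _ _ _ _ _ _ _ (hin 0 2 (k 0) (by decide) (by omega) (by omega))
      (hup 0 1 (k 0) (by omega) (by omega)) (hup 2 1 (k 0) (by omega) (by omega))
      (hup 0 3 (k 0) (by omega) (by omega)) (hup 2 3 (k 0) (by omega) (by omega))
      (hin 1 3 (k 0 + 1) (by decide) (by omega) (by omega))).elim
  · -- layers: k1 = k0+1, k2 = k0, k3 = k0-1
    exfalso; rcases hgap 1 3 (by decide) with h | h | h <;> omega
  · -- layers: k1 = k0+1, k2 = k0+1, k3 = k0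
    exact (no22 _ (hτ (k 0)) _ _ _ _ _ _ _ _ (hin 0 3 (k 0) (by decide) (by omega) (by omega))
      (hup 0 1 (k 0) (by omega) (by omega)) (hup 3 1 (k 0) (by omega) (by omega))
      (hup 0 2 (k 0) (by omega) (by omega)) (hup 3 2 (k 0) (by omega) (by omega))
      (hin 1 2 (k 0 + 1) (by decide) (by omega) (by omega))).elim
  · -- layers: k1 = k0+1, k2 = k0+1, k3 = k0+1
    exact ⟨0, k 0 + 1, fun m hm => by
        have : m = 0 ∨ m = 1 ∨ m = 2 ∨ m = 3 := by omega
        rcases this with rfl | rfl | rfl | rfl <;> omega, Or.inr (by omega)⟩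
  · -- layers: k1 = k0+1, k2 = k0+1, k3 = k0-1
    exfalso; rcases hgap 1 3 (by decide) with h | h | h <;> omega
  · -- layers: k1 = k0+1, k2 = k0-1, k3 = k0
    exfalso; rcases hgap 1 2 (by decide) with h | h | h <;> omega
  · -- layers: k1 = k0+1, k2 = k0-1, k3 = k0+1
    exfalso; rcases hgap 1 2 (by decide) with h | h | h <;> omega
  · -- layers: k1 = k0+1, k2 = k0-1, k3 = k0-1
    exfalso; rcases hgap 1 2 (by decide) with h | h | h <;> omega
  · -- layers: k1 = k0-1, k2 = k0, k3 = k0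
    exact ⟨1, k 0, fun m hm => by
        have : m = 0 ∨ m = 1 ∨ m = 2 ∨ m = 3 := by omega
        rcases this with rfl | rfl | rfl | rfl <;> omega, Or.inr (by omega)⟩
  · -- layers: k1 = k0-1, k2 = k0, k3 = k0+1
    exfalso; rcases hgap 3 1 (by decide) with h | h | h <;> omega
  · -- layers: k1 = k0-1, k2 = k0, k3 = k0-1
    exact (no22 _ (hτ (k 0 - 1)) _ _ _ _ _ _ _ _
      (hin 1 3 (k 0 - 1) (by decide) (by omega) (by omega))
      (hup 1 0 (k 0 - 1) (by omega) (by omega)) (hup 3 0 (k 0 - 1) (by omega) (by omega))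
      (hup 1 2 (k 0 - 1) (by omega) (by omega)) (hup 3 2 (k 0 - 1) (by omega) (by omega))
      (hin 0 2 (k 0) (by decide) (by omega) (by omega))).elim
  · -- layers: k1 = k0-1, k2 = k0+1, k3 = k0
    exfalso; rcases hgap 2 1 (by decide) with h | h | h <;> omega
  · -- layers: k1 = k0-1, k2 = k0+1, k3 = k0+1
    exfalso; rcases hgap 2 1 (by decide) with h | h | h <;> omega
  · -- layers: k1 = k0-1, k2 = k0+1, k3 = k0-1
    exfalso; rcases hgap 2 1 (by decide) with h | h | h <;> omega
  · -- layers: k1 = k0-1, k2 = k0-1, k3 = k0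
    exact (no22 _ (hτ (k 0 - 1)) _ _ _ _ _ _ _ _
      (hin 1 2 (k 0 - 1) (by decide) (by omega) (by omega))
      (hup 1 0 (k 0 - 1) (by omega) (by omega)) (hup 2 0 (k 0 - 1) (by omega) (by omega))
      (hup 1 3 (k 0 - 1) (by omega) (by omega)) (hup 2 3 (k 0 - 1) (by omega) (by omega))
      (hin 0 3 (k 0) (by decide) (by omega) (by omega))).elim
  · -- layers: k1 = k0-1, k2 = k0-1, k3 = k0+1
    exfalso; rcases hgap 3 1 (by decide) with h | h | h <;> omega
  · -- layers: k1 = k0-1, k2 = k0-1, k3 = k0-1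
    exact ⟨0, k 0 - 1, fun m hm => by
        have : m = 0 ∨ m = 1 ∨ m = 2 ∨ m = 3 := by omega
        rcases this with rfl | rfl | rfl | rfl <;> omega, Or.inl (by omega)⟩

end Summit.Ventures.Crystal3D

end
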